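import Mathlib
import Literature.NumberTheory.Transcendental.BoxIntegralZetaValues
import Literature.NumberTheory.Transcendental.KZMellinFibres
import Literature.NumberTheory.Transcendental.PeriodsWave0Proofs
import Literature.Barriers.KontsevichZagierPeriods.PeriodEqualityDecidability
import Literature.Barriers.KontsevichZagierPeriods.GrothendieckPeriodConjectureDependenceOddZetaProofs
import Summits.KontsevichZagierPeriods.KontsevichZagierPeriods.Theorems.SoloInformedPresRatTwo
import Summits.KontsevichZagierPeriods.KontsevichZagierPeriods.Theorems.SoloInformedKZPOne
import HarnessLib
import HarnessLib.Audit

/-!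
# SoloInformed — what the truncations `KZPUpTo N` decide: certificates against constants

Solo programme `solo-KontsevichZagierPeriods-informed`, session s118.

The summit `KontsevichZagierPeriods` is the conjunction of its truncations
`SoloInformedKZPUpTo N` — "any two *rational* integral representations (KZ's literal shape
`IntegralRep.IsRational`: `[σ, P/Q]`, `σ ⊆ ℝⁿ` `ℚ`-semialgebraic, `P, Q ∈ ℚ[x]`, `Q` zero-free on
`σ`) of dimensions `≤ N` with the same value are KZ-equivalent"
(`soloInformed_kzp_iff_forall_kzpUpTo`, file `SoloInformedPresRat`).  `KZPUpTo 1` is a THEOREM of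
the tree (`soloInformed_kzpUpTo_one`, Baker), `KZPUpTo 2` holds granting Ayoub's conjecture up to
torsion (`soloInformed_kzpUpTo_two_of_ayoubKZeffQ`).  This file records in the kernel, over built
modules only, what each truncation DECIDES about named constants, in the simplest certificate
language: a *certificate against constants* for a representation `R` is a KZ-equivalence
`R ∼ [pt, q]` with a rational constant `[pt, q] = constRep q` (dimension `0`, KZ's literal shape,
`Literature.Barriers.KontsevichZagierPeriods.KZ.constRep`); `SoloInformedNoConstCert R` says that
no such certificate exists.

* `soloInformed_noConstCert_of_irrational` — soundness alone: an irrational value admits no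
  certificate (unconditional, any representation).
* `soloInformed_kzpUpTo_noConstCert_iff` — **`KZPUpTo n → (NoConstCert R ↔ R.value ∉ ℚ)`** for
  every rational representation `R` of dimension `≤ n`: under the truncation, the irrationality of
  the value is EXACTLY the non-existence of a move certificate; `soloInformed_noConstCert_congr`
  transports this along any relation `R ∼ R'` (e.g. to the solid one Newton–Leibniz move above).
* `soloInformed_noConstCert_iff_of_dim_le_one` — dimension `≤ 1` is decided UNCONDITIONALLY
  (by the theorem `KZPUpTo 1`).
* `ζ(n)` (`n ≥ 2`) is the value of the `n`-dimensional rational representation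
  `Z_n = [(0,1)ⁿ, 1/(1 − x₀⋯x_{n−1})]` (`soloInformedZetaBoxRep`; value by the Literature theorem
  `BoxIntegral.setIntegral_box_one_div_one_sub_prod_eq_zetaValue`), so
  **`KZPUpTo n → (NoConstCert Z_n ↔ ζ(n) ∉ ℚ)`** (`soloInformed_kzpUpTo_noConstCert_zeta_iff`), in
  particular **`KZPUpTo 5 → (NoConstCert Z₅ ↔ ZetaFiveIrrational)`**; unconditionally
  `NoConstCert Z_{2k}` (`π` transcendental, tree) and `NoConstCert Z₃` (Apéry, tree).
* Catalan's constant is the value of the TWO-dimensional rational representation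
  `C = [(0,1)², 1/(1 + x₀²x₁²)]` (`soloInformed_value_catalanBoxRep`: term-wise integration of the
  alternating geometric series), so the FIRST undecided truncation already decides it:
  **`KZPUpTo 2 → (NoConstCert C ↔ CatalanIrrational)`**
  (`soloInformed_kzpUpTo_two_noConstCert_catalan_iff`), and granting Ayoub's conjecture up to
  torsion `NoConstCert C ↔ CatalanIrrational`
  (`soloInformed_noConstCert_catalan_iff_of_ayoubKZeffQ`).

So between the theorem `KZPUpTo 1` and the first undecided truncation `KZPUpTo 2` lies, on the
arithmetic side, the irrationality of Catalan's constant (OPEN): an unconditional proof of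
`KZPUpTo 2` would reduce `G ∉ ℚ` to the calculus statement `NoConstCert C`.  Compare the catalogued
strength barrier `Literature.Barriers.KontsevichZagierPeriods.zetaFiveIrrational_of_kz` (the FULL
summit, through the vendored print fact `kzConjecture_implies_oddZetaAlgIndep`, gives `ζ(5) ∉ ℚ`):
here the truncation at the constant's own dimension gives an EQUIVALENCE with a certificate
statement, with no vendored hypothesis.

References: M. Kontsevich, D. Zagier, *Periods* (2001), §1.1–1.2; J. Ayoub, *Une version relative
de la conjecture des périodes de Kontsevich–Zagier*, Ann. Math. 181 (2015), and EMS Newsl. 91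
(2014), Conj. 7, Rem. 13; M. Waldschmidt, *Open Diophantine problems*, Moscow Math. J. 4 (2004), §3
(irrationality of Catalan's constant and of `ζ(5)` open); F. Beukers, *A note on the irrationality
of `ζ(2)` and `ζ(3)`*, Bull. LMS 11 (1979) (the box integrals); W. Zudilin, *Arithmetic of
Catalan's constant and its relatives*, Abh. Math. Semin. Univ. Hambg. 89 (2019), §1.
-/

noncomputable section

open MeasureTheory Set Filter
open scoped Topology BigOperators

namespace Summit.KontsevichZagierPeriods.KontsevichZagierPeriods.Theorems

open Literature.NumberTheory.Transcendental Literature.NumberTheory.Transcendental.KZ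
open Literature.Barriers.KontsevichZagierPeriods.KZ (constRep constRep_isRational constRep_value)

variable {n k k' : ℕ}

/-! ### Certificates against constants -/

/-- **No certificate against constants**: the representation `R` is KZ-equivalent to no rational
constant `[pt, q] = constRep q` (`q ∈ ℚ`; a `0`-dimensional representation of KZ's literal shape).
A certificate `R ∼ [pt, q]` is a finite chain of the moves (1a), (1b), (2), (3). [this work] -/
def SoloInformedNoConstCert (R : IntegralRep k) : Prop :=
  ∀ q : ℚ, ¬ Equivalent R (constRep q)

/-- A certificate `R ∼ [pt, q]` forces `R.value = q` (soundness of the calculus,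
`Equivalent.value_eq_holds`). [Kontsevich–Zagier 2001, §1.2] -/
theorem soloInformed_value_eq_of_equivalent_constRep {R : IntegralRep k} {q : ℚ}
    (h : Equivalent R (constRep q)) : R.value = q :=
  (Equivalent.value_eq_holds h).trans (constRep_value q)

/-- **Soundness direction (unconditional)**: a representation with irrational value admits no
certificate against constants. [Kontsevich–Zagier 2001, §1.2] -/
theorem soloInformed_noConstCert_of_irrational (R : IntegralRep k) (h : Irrational R.value) :
    SoloInformedNoConstCert R :=
  fun q hq => h ⟨q, (soloInformed_value_eq_of_equivalent_constRep hq).symm⟩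

/-- **`KZPUpTo n → (NoConstCert R ↔ R.value ∉ ℚ)`** for every rational representation `R` of
dimension `k ≤ n`: under the period conjecture truncated at dimension `n`, the irrationality of
the value of `R` is exactly the non-existence of a move certificate `R ∼ [pt, q]` — the
truncation is applied once, to `R` and the `0`-dimensional rational representation `[pt, q]`.
[this work] -/
theorem soloInformed_kzpUpTo_noConstCert_iff (h : SoloInformedKZPUpTo n) (R : IntegralRep k)
    (hk : k ≤ n) (hR : R.IsRational) : SoloInformedNoConstCert R ↔ Irrational R.value := by
  refine ⟨fun hno => ?_, soloInformed_noConstCert_of_irrational R⟩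
  rintro ⟨q, hq⟩
  exact hno q (h R (constRep q) hk (Nat.zero_le n) hR (constRep_isRational q)
    (by rw [constRep_value]; exact hq.symm))

/-- Under `KZPUpTo n`, a rational representation of dimension `≤ n` with RATIONAL value `q` IS
equivalent to the constant `[pt, q]`: the truncation PRODUCES the certificate. [this work] -/
theorem soloInformed_kzpUpTo_equivalent_constRep (h : SoloInformedKZPUpTo n) (R : IntegralRep k)
    (hk : k ≤ n) (hR : R.IsRational) {q : ℚ} (hq : R.value = q) : Equivalent R (constRep q) :=
  h R (constRep q) hk (Nat.zero_le n) hR (constRep_isRational q) (by rw [constRep_value, hq])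

/-- Certificates against constants transport along relations: if `R ∼ R'` then
`NoConstCert R ↔ NoConstCert R'` (so the statement passes, e.g., from `[[0,1]ⁿ, 1/Q]` to the solid
under the graph of `1/Q`, one Newton–Leibniz move away). [this work] -/
theorem soloInformed_noConstCert_congr {R : IntegralRep k} {R' : IntegralRep k'}
    (hRR' : Equivalent R R') : SoloInformedNoConstCert R ↔ SoloInformedNoConstCert R' := by
  refine ⟨fun hno q hq => hno q ?_, fun hno q hq => hno q ?_⟩
  · have e : of R - of (constRep q) = (of R - of R') + (of R' - of (constRep q)) := by abel
    show of R - of (constRep q) ∈ relations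
    rw [e]
    exact relations.add_mem hRR' hq
  · have e : of R' - of (constRep q) = (of R - of (constRep q)) - (of R - of R') := by abel
    show of R' - of (constRep q) ∈ relations
    rw [e]
    exact relations.sub_mem hq hRR'

/-- **Dimension `≤ 1` is decided unconditionally**: for every rational representation `R` of
dimension `≤ 1`, `NoConstCert R ↔ R.value ∉ ℚ` — by the tree's theorem `KZPUpTo 1`
(`soloInformed_kzpUpTo_one`, Baker). [this work] -/
theorem soloInformed_noConstCert_iff_of_dim_le_one (R : IntegralRep k) (hk : k ≤ 1)
    (hR : R.IsRational) : SoloInformedNoConstCert R ↔ Irrational R.value :=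
  soloInformed_kzpUpTo_noConstCert_iff soloInformed_kzpUpTo_one R hk hR

/-- The whole summit decides every rational representation: `KontsevichZagierPeriods →
(NoConstCert R ↔ R.value ∉ ℚ)`. [this work] -/
theorem soloInformed_kz_noConstCert_iff (hKZ : KontsevichZagierPeriods) (R : IntegralRep k)
    (hR : R.IsRational) : SoloInformedNoConstCert R ↔ Irrational R.value :=
  soloInformed_kzpUpTo_noConstCert_iff (soloInformed_kzp_iff_forall_kzpUpTo.1 hKZ k) R le_rfl hR

/-! ### The representation `Z_n = [(0,1)ⁿ, 1/(1 − x₀⋯x_{n−1})]` of `ζ(n)` -/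

/-- `aeval x (1 − ∏ᵢ Xᵢ) = 1 − ∏ᵢ xᵢ`. -/
theorem soloInformed_aeval_one_sub_prod_X (x : Fin n → ℝ) :
    MvPolynomial.aeval x (1 - ∏ i, MvPolynomial.X i : MvPolynomial (Fin n) ℚ) = 1 - ∏ i, x i := by
  simp [map_prod]

/-- On the open unit box `1 − ∏ᵢ xᵢ > 0` (`n ≥ 1`). -/
theorem soloInformed_one_sub_prod_pos (hn : n ≠ 0) {x : Fin n → ℝ}
    (hx : ∀ i, x i ∈ Ioo (0 : ℝ) 1) : 0 < 1 - ∏ i, x i :=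
  sub_pos.2 (BoxIntegral.prod_mem_Ioo hn hx).2

/-- **`Z_n = [(0,1)ⁿ, 1/(1 − x₀⋯x_{n−1})]`** (`n ≥ 2`): the standard box representation of `ζ(n)`,
of KZ's literal rational shape — open unit box (a `ℚ`-semialgebraic domain), `P = 1`,
`Q = 1 − ∏ᵢ Xᵢ ∈ ℚ[x]` zero-free on the box, absolutely convergent by the Literature theorem
`BoxIntegral.integrableOn_box_one_div_one_sub_prod`. [Beukers 1979; Kontsevich–Zagier 2001, §1.1] -/
def soloInformedZetaBoxRep (n : ℕ) (hn : 2 ≤ n) : IntegralRep n :=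
  IntegralRep.ofRational {x : Fin n → ℝ | ∀ i, x i ∈ Ioo (0 : ℝ) 1} 1 (1 - ∏ i, MvPolynomial.X i)
    (KZ.isSemialgebraic_box n)
    (fun x hx => by
      rw [soloInformed_aeval_one_sub_prod_X]
      exact (soloInformed_one_sub_prod_pos (by omega) hx).ne')
    ((BoxIntegral.integrableOn_box_one_div_one_sub_prod hn).congr_fun
      (fun x _ => by rw [map_one, soloInformed_aeval_one_sub_prod_X])
      (Beukers.measurableSet_cube n))

/-- `Z_n` has KZ's literal rational shape. -/
theorem soloInformed_zetaBoxRep_isRational (hn : 2 ≤ n) :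
    (soloInformedZetaBoxRep n hn).IsRational :=
  IntegralRep.isRational_ofRational _ _ _ _ _ _

/-- **`value Z_n = ζ(n)`** (`n ≥ 2`; the Literature box-integral theorem). [Beukers 1979] -/
theorem soloInformed_value_zetaBoxRep (hn : 2 ≤ n) :
    (soloInformedZetaBoxRep n hn).value = zetaValue n := by
  rw [soloInformedZetaBoxRep, IntegralRep.value_ofRational,
    ← BoxIntegral.setIntegral_box_one_div_one_sub_prod_eq_zetaValue hn]
  refine setIntegral_congr_fun (Beukers.measurableSet_cube n) fun x _ => ?_
  rw [map_one, soloInformed_aeval_one_sub_prod_X]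

/-- **`KZPUpTo n → (NoConstCert Z_n ↔ ζ(n) ∉ ℚ)`** (`n ≥ 2`): under the period conjecture for
rational representations of dimensions `≤ n`, the irrationality of `ζ(n)` is exactly the
non-existence of a move certificate `Z_n ∼ [pt, q]`. [this work] -/
theorem soloInformed_kzpUpTo_noConstCert_zeta_iff (hn : 2 ≤ n) (h : SoloInformedKZPUpTo n) :
    SoloInformedNoConstCert (soloInformedZetaBoxRep n hn) ↔ Irrational (zetaValue n) := by
  rw [← soloInformed_value_zetaBoxRep hn]
  exact soloInformed_kzpUpTo_noConstCert_iff h _ le_rfl (soloInformed_zetaBoxRep_isRational hn)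

/-- **Face of the truncation `N = 5`: `KZPUpTo 5 → (NoConstCert Z₅ ↔ ζ(5) ∉ ℚ)`** — the right-hand
side is the OPEN statement `ZetaFiveIrrational`. [Waldschmidt 2004, §3] -/
theorem soloInformed_kzpUpTo_five_noConstCert_zeta_iff (h : SoloInformedKZPUpTo 5) :
    SoloInformedNoConstCert (soloInformedZetaBoxRep 5 (by norm_num)) ↔ ZetaFiveIrrational :=
  soloInformed_kzpUpTo_noConstCert_zeta_iff (by norm_num) h

/-- Every truncation `N ≥ 5` decides the `ζ(5)` face (monotonicity of the ladder). -/
theorem soloInformed_kzpUpTo_noConstCert_zetaFive_iff {N : ℕ} (hN : 5 ≤ N)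
    (h : SoloInformedKZPUpTo N) :
    SoloInformedNoConstCert (soloInformedZetaBoxRep 5 (by norm_num)) ↔ ZetaFiveIrrational :=
  soloInformed_kzpUpTo_five_noConstCert_zeta_iff (soloInformed_kzpUpTo_mono hN h)

/-- Unconditionally there is no certificate `Z_{2m} ∼ [pt, q]` (`m ≥ 1`): `ζ(2m)` is
transcendental (Euler + Lindemann, tree theorem `transcendental_zetaValue_two_mul`). -/
theorem soloInformed_noConstCert_zeta_two_mul {m : ℕ} (hm : m ≠ 0) :
    SoloInformedNoConstCert (soloInformedZetaBoxRep (2 * m) (by omega)) := by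
  refine soloInformed_noConstCert_of_irrational _ ?_
  rw [soloInformed_value_zetaBoxRep]
  exact (Literature.Barriers.KontsevichZagierPeriods.transcendental_zetaValue_two_mul hm).irrational

/-- Unconditionally there is no certificate `Z₃ ∼ [pt, q]` (Apéry, tree theorem
`irrational_zetaValue_three_holds`); so the truncation `N = 3` yields Apéry's certificate
statement for free. -/
theorem soloInformed_noConstCert_zeta_three :
    SoloInformedNoConstCert (soloInformedZetaBoxRep 3 (by norm_num)) := by
  refine soloInformed_noConstCert_of_irrational _ ?_
  rw [soloInformed_value_zetaBoxRep]
  exact irrational_zetaValue_three_holds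

/-! ### Dimension two: Catalan's constant `G = ∫_{(0,1)²} dx₀dx₁/(1 + x₀²x₁²)` -/

/-- `aeval x (1 + X₀²X₁²) = 1 + (x 0)²(x 1)²`. -/
theorem soloInformed_aeval_catalanDen (x : Fin 2 → ℝ) :
    MvPolynomial.aeval x (1 + MvPolynomial.X 0 ^ 2 * MvPolynomial.X 1 ^ 2 :
      MvPolynomial (Fin 2) ℚ) = 1 + x 0 ^ 2 * x 1 ^ 2 := by
  simp

/-- `1 + (x 0)²(x 1)² > 0`. -/
theorem soloInformed_catalanDen_pos (x : Fin 2 → ℝ) : 0 < 1 + x 0 ^ 2 * x 1 ^ 2 := by positivity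

/-- `x ↦ 1/(1 + x₀²x₁²)` is integrable on the open unit square (continuous on the closed one). -/
theorem soloInformed_integrableOn_catalanIntegrand :
    IntegrableOn (fun x : Fin 2 → ℝ => 1 / (1 + x 0 ^ 2 * x 1 ^ 2))
      {x : Fin 2 → ℝ | ∀ i, x i ∈ Ioo (0 : ℝ) 1} volume := by
  have hc : Continuous fun x : Fin 2 → ℝ => 1 / (1 + x 0 ^ 2 * x 1 ^ 2) :=
    continuous_const.div (by fun_prop) fun x => (soloInformed_catalanDen_pos x).ne'
  refine (hc.continuousOn.integrableOn_compact
    (isCompact_univ_pi fun _ : Fin 2 => (isCompact_Icc : IsCompact (Icc (0 : ℝ) 1)))).mono_set ?_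
  rw [Beukers.setOf_forall_mem_Ioo_eq_pi]
  exact Set.pi_mono fun _ _ => Ioo_subset_Icc_self

/-- **`C = [(0,1)², 1/(1 + x₀²x₁²)]`**, a two-dimensional representation of KZ's literal rational
shape (open unit box, `P = 1`, `Q = 1 + X₀²X₁²` zero-free everywhere).
[Kontsevich–Zagier 2001, §1.1] -/
def soloInformedCatalanBoxRep : IntegralRep 2 :=
  IntegralRep.ofRational {x : Fin 2 → ℝ | ∀ i, x i ∈ Ioo (0 : ℝ) 1} 1
    (1 + MvPolynomial.X 0 ^ 2 * MvPolynomial.X 1 ^ 2) (KZ.isSemialgebraic_box 2)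
    (fun x _ => by rw [soloInformed_aeval_catalanDen]; exact (soloInformed_catalanDen_pos x).ne')
    (soloInformed_integrableOn_catalanIntegrand.congr_fun
      (fun x _ => by rw [map_one, soloInformed_aeval_catalanDen]) (Beukers.measurableSet_cube 2))

/-- `C` has KZ's literal rational shape. -/
theorem soloInformed_catalanBoxRep_isRational : soloInformedCatalanBoxRep.IsRational :=
  IntegralRep.isRational_ofRational _ _ _ _ _ _

/-- `∫_{(0,1)²} (−1)ᵏ (x₀x₁)^{2k} = (−1)ᵏ (1/(2k+1))²`. [folklore] -/
theorem soloInformed_setIntegral_catalanTerm (k : ℕ) :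
    ∫ x in {x : Fin 2 → ℝ | ∀ i, x i ∈ Ioo (0 : ℝ) 1}, (-1 : ℝ) ^ k * (∏ i, x i) ^ (2 * k) =
      (-1 : ℝ) ^ k * (1 / (((2 * k : ℕ) : ℝ) + 1)) ^ 2 := by
  rw [integral_const_mul, BoxIntegral.setIntegral_box_prod_pow 2 (2 * k)]

/-- `∫_{(0,1)²} |(−1)ᵏ (x₀x₁)^{2k}| = (1/(2k+1))²`. [folklore] -/
theorem soloInformed_setIntegral_norm_catalanTerm (k : ℕ) :
    ∫ x in {x : Fin 2 → ℝ | ∀ i, x i ∈ Ioo (0 : ℝ) 1}, ‖(-1 : ℝ) ^ k * (∏ i, x i) ^ (2 * k)‖ =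
      (1 / (((2 * k : ℕ) : ℝ) + 1)) ^ 2 := by
  rw [← BoxIntegral.setIntegral_box_prod_pow 2 (2 * k)]
  refine setIntegral_congr_fun (Beukers.measurableSet_cube 2) fun x hx => ?_
  rw [norm_mul, norm_pow, norm_neg, norm_one, one_pow, one_mul,
    Real.norm_of_nonneg (pow_nonneg (Finset.prod_nonneg fun i _ => (hx i).1.le) _)]

/-- Pointwise on the open unit square: `Σ_k (−1)ᵏ (x₀x₁)^{2k} = 1/(1 + x₀²x₁²)`
(geometric series, ratio `−(x₀x₁)²` of absolute value `< 1`). [folklore] -/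
theorem soloInformed_hasSum_catalanIntegrand {x : Fin 2 → ℝ} (hx : ∀ i, x i ∈ Ioo (0 : ℝ) 1) :
    HasSum (fun k : ℕ => (-1 : ℝ) ^ k * (∏ i, x i) ^ (2 * k)) (1 / (1 + x 0 ^ 2 * x 1 ^ 2)) := by
  have hu := BoxIntegral.prod_mem_Ioo (n := 2) two_ne_zero hx
  have hgeo : HasSum (fun k : ℕ => (-((∏ i, x i) ^ 2)) ^ k) (1 - -((∏ i, x i) ^ 2))⁻¹ :=
    hasSum_geometric_of_abs_lt_one (by
      rw [abs_neg, abs_pow, abs_of_pos hu.1]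
      exact pow_lt_one₀ hu.1.le hu.2 two_ne_zero)
  have e : (1 - -((∏ i, x i) ^ 2))⁻¹ = 1 / (1 + x 0 ^ 2 * x 1 ^ 2) := by
    rw [sub_neg_eq_add, Fin.prod_univ_two, mul_pow, one_div]
  rw [e] at hgeo
  refine hgeo.congr_fun fun k => ?_
  rw [pow_mul]
  exact (neg_pow _ k).symm

/-- **Term-wise integration on the open unit square**:
`Σ_k (−1)ᵏ/(2k+1)² = ∫_{(0,1)²} dx/(1 + x₀²x₁²)` (absolute convergence:
`Σ_k ∫ |(−1)ᵏ(x₀x₁)^{2k}| = Σ_k 1/(2k+1)² < ∞`). [folklore] -/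
theorem soloInformed_hasSum_catalan_box :
    HasSum (fun k : ℕ => (-1 : ℝ) ^ k / ((2 * k + 1 : ℝ)) ^ 2)
      (∫ x in {x : Fin 2 → ℝ | ∀ i, x i ∈ Ioo (0 : ℝ) 1}, 1 / (1 + x 0 ^ 2 * x 1 ^ 2)) := by
  have hF_int : ∀ k : ℕ, Integrable (fun x : Fin 2 → ℝ => (-1 : ℝ) ^ k * (∏ i, x i) ^ (2 * k))
      (volume.restrict {x : Fin 2 → ℝ | ∀ i, x i ∈ Ioo (0 : ℝ) 1}) := fun k =>
    (BoxIntegral.integrableOn_box_prod_pow 2 (2 * k)).const_mul _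
  have hsum : Summable fun k : ℕ =>
      ∫ x in {x : Fin 2 → ℝ | ∀ i, x i ∈ Ioo (0 : ℝ) 1}, ‖(-1 : ℝ) ^ k * (∏ i, x i) ^ (2 * k)‖ := by
    refine (Summable.of_nonneg_of_le (fun k => by positivity) (fun k => ?_)
      (BoxIntegral.summable_one_div_succ_pow' (n := 2) le_rfl) :
        Summable fun k : ℕ => (1 / (((2 * k : ℕ) : ℝ) + 1)) ^ 2).congr
      fun k => (soloInformed_setIntegral_norm_catalanTerm k).symm
    have hk : (k : ℝ) + 1 ≤ ((2 * k : ℕ) : ℝ) + 1 := by push_cast; linarith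
    exact pow_le_pow_left₀ (by positivity) (one_div_le_one_div_of_le (by positivity) hk) 2
  have h := hasSum_integral_of_summable_integral_norm hF_int hsum
  rw [setIntegral_congr_fun (Beukers.measurableSet_cube 2) fun x hx =>
    (soloInformed_hasSum_catalanIntegrand hx).tsum_eq] at h
  refine h.congr_fun fun k => ?_
  rw [soloInformed_setIntegral_catalanTerm]
  push_cast
  rw [one_div_pow, mul_one_div]

/-- **`value C = G`** (Catalan's constant `catalanConstant = Σ_k (−1)ᵏ/(2k+1)²` of `PeriodsWave0`,
`hasSum_catalanConstant`). [folklore; Zudilin 2019, §1] -/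
theorem soloInformed_value_catalanBoxRep : soloInformedCatalanBoxRep.value = catalanConstant := by
  have e : ∀ x : Fin 2 → ℝ, MvPolynomial.aeval x (1 : MvPolynomial (Fin 2) ℚ) /
      MvPolynomial.aeval x (1 + MvPolynomial.X 0 ^ 2 * MvPolynomial.X 1 ^ 2 :
        MvPolynomial (Fin 2) ℚ) = 1 / (1 + x 0 ^ 2 * x 1 ^ 2) := fun x => by
    rw [map_one, soloInformed_aeval_catalanDen]
  rw [soloInformedCatalanBoxRep, IntegralRep.value_ofRational]
  simp_rw [e]
  exact soloInformed_hasSum_catalan_box.unique hasSum_catalanConstant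

/-- **Face of the FIRST undecided truncation: `KZPUpTo 2 → (NoConstCert C ↔ CatalanIrrational)`.**
Under the period conjecture for rational representations of dimensions `≤ 2`, the irrationality of
Catalan's constant (OPEN) is exactly the non-existence of a move certificate
`[(0,1)², 1/(1 + x₀²x₁²)] ∼ [pt, q]`. [this work; Waldschmidt 2004, §3] -/
theorem soloInformed_kzpUpTo_two_noConstCert_catalan_iff (h : SoloInformedKZPUpTo 2) :
    SoloInformedNoConstCert soloInformedCatalanBoxRep ↔ CatalanIrrational := by
  rw [CatalanIrrational, ← soloInformed_value_catalanBoxRep]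
  exact soloInformed_kzpUpTo_noConstCert_iff h _ le_rfl soloInformed_catalanBoxRep_isRational

/-- Every truncation `N ≥ 2` decides the Catalan face. -/
theorem soloInformed_kzpUpTo_noConstCert_catalan_iff {N : ℕ} (hN : 2 ≤ N)
    (h : SoloInformedKZPUpTo N) :
    SoloInformedNoConstCert soloInformedCatalanBoxRep ↔ CatalanIrrational :=
  soloInformed_kzpUpTo_two_noConstCert_catalan_iff (soloInformed_kzpUpTo_mono hN h)

/-- **Granting Ayoub's conjecture up to torsion** (`SoloInformedAyoubKZeffQ`, which gives
`KZPUpTo 2` by the tree's THEOREM PRES-RAT(2), `soloInformed_kzpUpTo_two_of_ayoubKZeffQ`):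
`NoConstCert C ↔ G ∉ ℚ`. [Ayoub 2014, Conj. 7, Rem. 13; this work] -/
theorem soloInformed_noConstCert_catalan_iff_of_ayoubKZeffQ (hA : SoloInformedAyoubKZeffQ) :
    SoloInformedNoConstCert soloInformedCatalanBoxRep ↔ CatalanIrrational :=
  soloInformed_kzpUpTo_two_noConstCert_catalan_iff (soloInformed_kzpUpTo_two_of_ayoubKZeffQ hA)

/-- If Catalan's constant were rational, `G = q`, then granting Ayoub's conjecture up to torsion
the calculus would contain an explicit certificate `[(0,1)², 1/(1 + x₀²x₁²)] ∼ [pt, q]`. -/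
theorem soloInformed_catalan_certificate_of_rational_of_ayoubKZeffQ (hA : SoloInformedAyoubKZeffQ)
    {q : ℚ} (hq : catalanConstant = q) : Equivalent soloInformedCatalanBoxRep (constRep q) :=
  soloInformed_kzpUpTo_equivalent_constRep (soloInformed_kzpUpTo_two_of_ayoubKZeffQ hA) _ le_rfl
    soloInformed_catalanBoxRep_isRational (by rw [soloInformed_value_catalanBoxRep, hq])

/-- Consistency with the summit: `KontsevichZagierPeriods` decides both faces. -/
theorem soloInformed_kz_noConstCert_faces (hKZ : KontsevichZagierPeriods) :
    (SoloInformedNoConstCert soloInformedCatalanBoxRep ↔ CatalanIrrational) ∧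
      (SoloInformedNoConstCert (soloInformedZetaBoxRep 5 (by norm_num)) ↔ ZetaFiveIrrational) :=
  ⟨soloInformed_kzpUpTo_two_noConstCert_catalan_iff (soloInformed_kzp_iff_forall_kzpUpTo.1 hKZ 2),
    soloInformed_kzpUpTo_five_noConstCert_zeta_iff (soloInformed_kzp_iff_forall_kzpUpTo.1 hKZ 5)⟩

end Summit.KontsevichZagierPeriods.KontsevichZagierPeriods.Theorems
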